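import Summits.KontsevichZagierPeriods.Zeta5Search.WedgeDictionaryLevelDescentFaceBase
import Summits.KontsevichZagierPeriods.Zeta5Search.DualSeriesLemma19Record
import HarnessLib

/-!
# Level descent (LD@N) — the level `N = 0` — PROVED (from the face value of `U`)

HONEST FRAMING: systematic search; no irrationality claim unless certified.

gen-1 g7 (planner-pub-zeta5-gen-1-g7-0).  The only `LDBoxHyp` shape with `N = 0` is `b = 0` (on the slots `0..7`).  There
`U(b + e₇) = 0` (double zero of the numerator polynomial at the origin, P1's `coeffU_eq_zero_of_sq_dvd`), `U(b) = faceValue b = 2` by the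
face value of `U` (`coeffU_faceExt_stmt`, the shape lies on `b₁ + b₂ = N`), and `X(b♭) = X(b + e₇)` for `X = W, V` by the slot symmetry
(`b♭ = (b + e₇) ∘ (1 7)`); so both m-indexed identities read `2·X(b + e₇) = 2·X(b + e₇)`.
Main result: `ldZero_holds : ldZero_stmt`, where `ldZero_stmt : coeffU_faceExt_stmt → ∀ b, LDBoxHyp b → b 0 = 0 → casUW b = ldSum W b ∧ casUV b = ldSum V b`.
-/

open Finset Polynomial

namespace Summit.KontsevichZagierPeriods.Zeta5Search.WedgeDictionary

open Summit.KontsevichZagierPeriods.Zeta5Search.DualSeries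
open Summit.KontsevichZagierPeriods.Zeta5Search.DualSeriesLemma19 (coeffV_swap)


section zero
variable (b : ℕ → ℤ) (h0 : b 0 = 0) (h1 : b 1 = 0) (h2 : b 2 = 0) (h3 : b 3 = 0) (h4 : b 4 = 0) (h5 : b 5 = 0)
  (h6 : b 6 = 0) (h7 : b 7 = 0)
include h0 h1 h2 h3 h4 h5 h6 h7

/-- At level `0`: `U(b + e₇) = 0`. -/
theorem coeffU_bump6_levelZero : coeffU (bump b 6) = 0 := by
  have hv : ∀ s, bump b 6 s = if s = 7 then 1 else b s := fun s => by
    simp only [bump, Nat.reduceAdd, Function.update_apply, h7, zero_add]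
  have e0 : bump b 6 0 = 0 := by rw [hv]; simp [h0]
  have e7 : bump b 6 7 = 1 := by rw [hv]; simp
  refine LevelDescent.coeffU_eq_zero_of_sq_dvd (bump b 6) ?_ ?_ ?_
  · rw [inBox_iff]; simp only [hv]; simp; omega
  · simp only [sum_range_succ, sum_range_zero, Nat.reduceAdd, hv]; simp; omega
  · rw [e0, Int.toNat_zero, zero_add]
    unfold numPoly
    refine dvd_mul_of_dvd_right (dvd_trans ?_ (dvd_prod_of_mem _ (show 6 ∈ range 7 by simp))) _
    simp only [Nat.reduceAdd, e7, e0]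
    norm_num
    rw [sq]

omit h3 h4 h5 h6 in
/-- At level `0`: `b♭ = (b + e₇) ∘ (1 7)`. -/
theorem faceShape_levelZero : LevelDescent.faceShape b = fun i => bump b 6 (Equiv.swap 1 7 i) := by
  funext s
  rw [LevelDescent.faceShape_apply]
  simp only [bump, Nat.reduceAdd, Function.update_apply, Equiv.swap_apply_def]
  by_cases hs1 : s = 1
  · subst hs1; simp [h0, h7]
  · by_cases hs7 : s = 7
    · subst hs7; simp [h1, h7]
    · by_cases hs2 : s = 2
      · subst hs2; simp [h2]
      · simp [hs1, hs7, hs2]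

/-- At level `0`: `faceSupp b`, `faceValue b = 2`. -/
theorem faceValue_levelZero : faceSupp b ∧ faceValue b = 2 := by
  refine ⟨fun j hj => ?_, ?_⟩
  · rw [Icc_three_seven] at hj
    simp only [mem_insert, mem_singleton] at hj
    rcases hj with rfl | rfl | rfl | rfl | rfl <;> simp [h0, h1, h2, h3, h4, h5, h6, h7]
  · unfold faceValue sumB
    rw [Icc_three_seven]
    simp [facQ, h0, h1, h2, h3, h4, h5, h6, h7]

/-- At level `0`: both m-indexed identities. -/
theorem ldZero_core (hU : coeffU_faceExt_stmt) (hd : 0 ≤ dOf b) :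
    casUW b = ldSum coeffW b ∧ casUV b = ldSum coeffV b := by
  have hS : ∀ j ∈ Icc 1 7, 0 ≤ b j ∧ b j ≤ b 0 := by
    intro j hj
    have e : (Icc 1 7 : Finset ℕ) = {1, 2, 3, 4, 5, 6, 7} := by decide
    rw [e] at hj
    simp only [mem_insert, mem_singleton] at hj
    rcases hj with rfl | rfl | rfl | rfl | rfl | rfl | rfl <;> simp [h0, h1, h2, h3, h4, h5, h6, h7]
  have h12 : b 1 + b 2 = b 0 := by rw [h1, h2, h0]; norm_num
  obtain ⟨hfs, hfv⟩ := faceValue_levelZero b h0 h1 h2 h3 h4 h5 h6 h7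
  have hU2 : coeffU b = 2 := by rw [hU b (by omega) hS hd h12, if_pos hfs, hfv]
  have hU7 : coeffU (bump b 6) = 0 := coeffU_bump6_levelZero b h0 h1 h2 h3 h4 h5 h6 h7
  have hsupp : ldSupp b (b 7) := (faceSupp_iff_ldSupp b h12 (by rw [h7])).1 hfs
  have hface := faceShape_levelZero b h0 h1 h2 h7
  have hW : coeffW (LevelDescent.faceShape b) = coeffW (bump b 6) := by
    rw [hface]; exact coeffW_swap (bump b 6) (by simp) (by simp)
  have hV : coeffV (LevelDescent.faceShape b) = coeffV (bump b 6) := by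
    rw [hface]; exact coeffV_swap (bump b 6) (by simp) (by simp)
  constructor
  · unfold casUW
    rw [ldSum_face coeffW b (by omega) hS hd h12, if_pos hsupp, hfv, hW, hU2, hU7]; ring
  · unfold casUV
    rw [ldSum_face coeffV b (by omega) hS hd h12, if_pos hsupp, hfv, hV, hU2, hU7]; ring

end zero

/-- STATEMENT (PROVED below as `ldZero_holds`): the m-indexed level-descent identities at level `N = 0`, from the face value of `U`. -/
def ldZero_stmt : Prop :=
  coeffU_faceExt_stmt → ∀ b : ℕ → ℤ, LDBoxHyp b → b 0 = 0 → casUW b = ldSum coeffW b ∧ casUV b = ldSum coeffV b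

/-- `ldZero_stmt` holds. -/
theorem ldZero_holds : ldZero_stmt := by
  intro hU b hb hN
  have hs := (inBox_iff b).1 hb.1
  have hB := hb.2.1
  have e : (Icc 1 7 : Finset ℕ) = {1, 2, 3, 4, 5, 6, 7} := by decide
  rw [e] at hB
  simp only [mem_insert, mem_singleton, forall_eq_or_imp, forall_eq] at hB
  exact ldZero_core b hN (by omega) (by omega) (by omega) (by omega) (by omega) (by omega) (by omega) hU hb.2.2.1

end Summit.KontsevichZagierPeriods.Zeta5Search.WedgeDictionary
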